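import Mathlib
import Summits.MatrixMultiplication.MatrixMultiplication.Theorems.LevelGradedCohnUmansLevelOneGL2DesignsTangencyParabolaLift

/-!
# Quadratic-order parabola lifts for `stub_tangencySets` (crux `LevelOneGL2Designs`,
stmt-MatrixMultiplication-14080; wall-breaker k8, axis "parabola lifts over finite fields")

The parabola lift of Hunter–Pohoata–Verstraëte–Zhang (arXiv:2601.19879, Prop. 2.3; in this tree
`ParabolaLift.srs_of_sqDiffFree` / `ParabolaLift.srs_of_sqDiff_disjoint`) reads a
square-difference-free set of *rational* integers inside `𝔽_p` and produces a strong representative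
system (tangency set, induced point–line matching) of `AG(2,p)` of size `≍ p^{1/2}·|A|`; with
Ruzsa–Lewko sets this is `p^{1.2334}` for every prime, the published record.

This file runs the same lift through a *quadratic order* `ℤ[√d]` (Mathlib's `ℤ√d`) and a ring
homomorphism `φ : ℤ√d →+* ZMod p` (a square root of `d` mod `p`, `Zsqrtd.lift`), i.e. through a
degree-one prime of `ℤ[√d]` above `p`:

* `eq_zero_of_map_eq_zero` — NO WRAP-AROUND: `φ α = 0` and `|N(α)| < p` force `α = 0`
  (`p ∣ N(α)` because `N(α) = α·ᾱ`, and the norm form of a non-square `d` is anisotropic).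
* `quadLift_srs` — ABSTRACT LIFT: finite `X, K ⊆ ℤ√d`, `K` square-difference-free in `ℤ√d`
  (`k - k' = z² ⇒ z = 0`) and all `(x'-x)² - (k-k')` of norm `< p` in absolute value ⟹ the parameter
  sets `φ(X), φ(K) ⊆ 𝔽_p` satisfy the incidence identity (★) of the master lemma
  `ParabolaLift.srs_of_sqDiff_disjoint`, whence an SRS of `AG(2,p)` with at least `|X|·|K| - 2|K|`
  flags, in the exact format of `stub_tangencySets`.
* `quadLift_box_srs` — BOX VERSION: `X ⊆ [0,m)²`, `K ⊆ [0,L)²` (coordinates of `ℤ√d`) satisfy the norm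
  condition as soon as `((1+|d|)m² + L)² + |d|(2m² + L)² < p`.
* `exists_box` — the box `[0,m)²` itself (`m²` elements).

With `|X| = m² ≍ p^{1/2}` and `K ⊆ [0,L)²`, `L ≍ p^{1/2}`, square-difference-free of size `(L²)^{3/4}`
(inert-prime digit sets, `…QuadraticLiftDigits.lean`), this gives SRS of size `≫ p^{5/4}` for every
prime that splits in one of `ℤ[√2], ℤ[√-2], ℤ[√-1]`, i.e. for EVERY odd prime
(`…QuadraticLiftExponent.lean`; the Gaussian case `p ≡ 1 (mod 4)` is also wall-breaker k2's
`…GaussLift…`).  The exponent `5/4 = 1/2 + 3/4` exceeds the record `1.2334 = 1/2 + 0.7334` because an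
inert prime `ℓ` of `ℤ[√d]` has residue field `𝔽_{ℓ²}`, whose Paley graph has cocliques of size
exactly `ℓ = √(ℓ²)` — the square-root size that rational digit bases cannot reach.

References: Hunter–Pohoata–Verstraëte–Zhang, arXiv:2601.19879 (2026), Prop. 2.3, Thm. 1.2
[bib: HunterPohoataVerstraeteZhang2026]; I. Z. Ruzsa, Period. Math. Hungar. 15 (1984) 205–209
[bib: Ruzsa1984DifferenceSetsWithoutSquares].  The quadratic-order version is new here (elementary;
no definitions are introduced).
-/

-- justification: the summit/problem path `MatrixMultiplication.MatrixMultiplication` is fixed by the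
-- tree layout (D-0017), so the namespace necessarily repeats a component.
set_option linter.dupNamespace false

open Matrix Finset

namespace Summit.MatrixMultiplication.MatrixMultiplication.Theorems.LevelOneGL2Designs.QuadraticLift

variable {d : ℤ} {p : ℕ} [Fact p.Prime]

/-- **No wrap-around through a degree-one prime.**  If `φ : ℤ√d →+* 𝔽_p` kills `α` and
`|N(α)| < p`, then `α = 0`: indeed `φ(N α) = φ(α)·φ(ᾱ) = 0`, so `p ∣ N(α)`, so `N(α) = 0`, and the norm
form of a non-square `d` is anisotropic. [elementary] -/
theorem eq_zero_of_map_eq_zero (hd : ∀ n : ℤ, d ≠ n * n) (φ : ℤ√d →+* ZMod p) {α : ℤ√d}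
    (hα : φ α = 0) (hsmall : |α.norm| < p) : α = 0 := by
  have hdvd : (p : ℤ) ∣ α.norm := by
    rw [← ZMod.intCast_zmod_eq_zero_iff_dvd]
    have h2 : φ (α.norm : ℤ√d) = 0 := by
      rw [Zsqrtd.norm_eq_mul_conj, map_mul, hα, zero_mul]
    rwa [map_intCast] at h2
  exact (Zsqrtd.norm_eq_zero hd α).mp (Int.eq_zero_of_abs_lt_dvd hdvd hsmall)

/-- **Quadratic-order parabola lift (abstract form).**  Let `φ : ℤ√d →+* 𝔽_p` (`d` a non-square),
`X, K ⊆ ℤ√d` finite, `K` square-difference-free in `ℤ√d`, and suppose every element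
`(x' - x)² - (k - k')` (`x, x' ∈ X`, `k, k' ∈ K`) has norm of absolute value `< p`.  Then `φ` is
injective on `X` and on `K`, the parameter sets `T = φ(X)`, `S = φ(K)` satisfy the incidence identity
`(t-t')² = s-s' ⇒ t = t' ∧ s = s'` of the parabola lift, and `ParabolaLift.srs_of_sqDiff_disjoint` yields
a strong representative system of `AG(2,p)` with at least `|X|·|K| - 2|K|` flags, in the format of
`stub_tangencySets`. [elementary; the mechanism is HPVZ 2026 Prop. 2.3 run in `ℤ[√d]` instead of `ℤ`] -/
theorem quadLift_srs (hd : ∀ n : ℤ, d ≠ n * n) (φ : ℤ√d →+* ZMod p) (X K : Finset (ℤ√d))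
    (hK : ∀ k ∈ K, ∀ k' ∈ K, ∀ z : ℤ√d, k - k' = z * z → z = 0)
    (hwrap : ∀ x ∈ X, ∀ x' ∈ X, ∀ k ∈ K, ∀ k' ∈ K,
      |((x' - x) * (x' - x) - (k - k')).norm| < p) :
    ∃ S : Finset ((Fin 2 → ZMod p) × (Fin 2 → ZMod p)), X.card * K.card ≤ S.card + 2 * K.card ∧
      ∀ f ∈ S, ∀ f' ∈ S, (dotProduct f.1 f'.2 = 1 ↔ f = f') := by
  classical
  -- degenerate cases
  rcases X.eq_empty_or_nonempty with hXe | ⟨x₀, hx₀⟩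
  · exact ⟨∅, by simp [hXe], by simp⟩
  rcases K.eq_empty_or_nonempty with hKe | ⟨k₀, hk₀⟩
  · exact ⟨∅, by simp [hKe], by simp⟩
  -- a tangency relation in `𝔽_p` lifts to a square difference in `ℤ√d`
  have key : ∀ x ∈ X, ∀ x' ∈ X, ∀ k ∈ K, ∀ k' ∈ K,
      (φ x' - φ x) ^ 2 = φ k - φ k' → x' = x ∧ k = k' := by
    intro x hx x' hx' k hk k' hk' h
    have h1 : φ ((x' - x) * (x' - x) - (k - k')) = 0 := by
      simp only [map_sub, map_mul]
      rw [← h]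
      ring
    have h2 := eq_zero_of_map_eq_zero hd φ h1 (hwrap x hx x' hx' k hk k' hk')
    have h3 : k - k' = (x' - x) * (x' - x) := (sub_eq_zero.mp h2).symm
    have h4 : x' - x = 0 := hK k hk k' hk' _ h3
    refine ⟨sub_eq_zero.mp h4, ?_⟩
    rw [h4, mul_zero] at h3
    exact sub_eq_zero.mp h3
  have hinjX : Set.InjOn φ ↑X := by
    intro x hx x' hx' h
    exact ((key x hx x' hx' k₀ hk₀ k₀ hk₀ (by rw [h, sub_self, sub_self]; ring)).1).symm
  have hinjK : Set.InjOn φ ↑K := by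
    intro k hk k' hk' h
    exact (key x₀ hx₀ x₀ hx₀ k hk k' hk' (by rw [h, sub_self, sub_self]; ring)).2
  obtain ⟨S, hScard, hS⟩ := ParabolaLift.srs_of_sqDiff_disjoint (X.image φ) (K.image φ) (by
    intro t ht s hs t' ht' s' hs' h
    rw [mem_image] at ht hs ht' hs'
    obtain ⟨x, hx, rfl⟩ := ht
    obtain ⟨k, hk, rfl⟩ := hs
    obtain ⟨x', hx', rfl⟩ := ht'
    obtain ⟨k', hk', rfl⟩ := hs'
    obtain ⟨h1, h2⟩ := key x' hx' x hx k hk k' hk' h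
    rw [h1, h2]
    exact ⟨rfl, rfl⟩)
  refine ⟨S, ?_, hS⟩
  rwa [card_image_of_injOn hinjX, card_image_of_injOn hinjK] at hScard

/-- Coordinate bound for the norm form: `|N(w)| = |re² - d·im²| ≤ re² + |d|·im²`. [elementary] -/
theorem abs_norm_le (w : ℤ√d) : |w.norm| ≤ w.re ^ 2 + |d| * w.im ^ 2 := by
  rw [Zsqrtd.norm_def]
  calc |w.re * w.re - d * w.im * w.im| ≤ |w.re * w.re| + |d * w.im * w.im| := abs_sub _ _
    _ = w.re ^ 2 + |d| * w.im ^ 2 := by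
        rw [abs_mul_self, mul_assoc, abs_mul, abs_mul_self]
        ring

/-- Bounding `|N(u² - v)|` on a box: if `|u.re|, |u.im| ≤ m` and `|v.re|, |v.im| ≤ L` then
`|N(u·u - v)| ≤ ((1+|d|)m² + L)² + |d|(2m² + L)²`. [elementary] -/
theorem abs_norm_sq_sub_le (u v : ℤ√d) (m L : ℤ) (hm : 0 ≤ m)
    (hure : |u.re| ≤ m) (huim : |u.im| ≤ m) (hvre : |v.re| ≤ L) (hvim : |v.im| ≤ L) :
    |(u * u - v).norm| ≤ ((1 + |d|) * m ^ 2 + L) ^ 2 + |d| * (2 * m ^ 2 + L) ^ 2 := by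
  have hre : |(u * u - v).re| ≤ (1 + |d|) * m ^ 2 + L := by
    have h1 : (u * u - v).re = u.re * u.re + d * (u.im * u.im) - v.re := by
      simp only [Zsqrtd.re_sub, Zsqrtd.re_mul]
      ring
    rw [h1]
    have h2 : |u.re * u.re| ≤ m ^ 2 := by
      rw [abs_mul, sq]
      exact mul_le_mul hure hure (abs_nonneg _) hm
    have h3 : |d * (u.im * u.im)| ≤ |d| * m ^ 2 := by
      rw [abs_mul, abs_mul, sq]
      exact mul_le_mul_of_nonneg_left (mul_le_mul huim huim (abs_nonneg _) hm) (abs_nonneg _)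
    calc |u.re * u.re + d * (u.im * u.im) - v.re|
        ≤ |u.re * u.re + d * (u.im * u.im)| + |v.re| := abs_sub _ _
      _ ≤ (|u.re * u.re| + |d * (u.im * u.im)|) + |v.re| := by
          gcongr
          exact abs_add_le _ _
      _ ≤ (m ^ 2 + |d| * m ^ 2) + L := by gcongr
      _ = (1 + |d|) * m ^ 2 + L := by ring
  have him : |(u * u - v).im| ≤ 2 * m ^ 2 + L := by
    have h1 : (u * u - v).im = 2 * (u.re * u.im) - v.im := by
      simp only [Zsqrtd.im_sub, Zsqrtd.im_mul]
      ring
    rw [h1]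
    have h2 : |2 * (u.re * u.im)| ≤ 2 * m ^ 2 := by
      rw [abs_mul, abs_two, abs_mul, sq]
      exact mul_le_mul_of_nonneg_left (mul_le_mul hure huim (abs_nonneg _) hm) zero_le_two
    calc |2 * (u.re * u.im) - v.im| ≤ |2 * (u.re * u.im)| + |v.im| := abs_sub _ _
      _ ≤ 2 * m ^ 2 + L := by gcongr
  have hL : 0 ≤ L := le_trans (abs_nonneg _) hvre
  have hA : 0 ≤ (1 + |d|) * m ^ 2 + L := by positivity
  have hB : 0 ≤ 2 * m ^ 2 + L := by positivity
  calc |(u * u - v).norm| ≤ (u * u - v).re ^ 2 + |d| * (u * u - v).im ^ 2 := abs_norm_le _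
    _ ≤ ((1 + |d|) * m ^ 2 + L) ^ 2 + |d| * (2 * m ^ 2 + L) ^ 2 := by
        gcongr ?_ + |d| * ?_
        · exact sq_le_sq' (by linarith [neg_abs_le (u * u - v).re]) (le_trans (le_abs_self _) hre)
        · exact sq_le_sq' (by linarith [neg_abs_le (u * u - v).im]) (le_trans (le_abs_self _) him)

/-- **Quadratic-order parabola lift, box version.**  `φ : ℤ√d →+* 𝔽_p` (`d` a non-square),
`X ⊆ [0,m)²`, `K ⊆ [0,L)²` (coordinates of `ℤ√d`), `K` square-difference-free in `ℤ√d`, and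
`((1+|d|)m² + L)² + |d|(2m² + L)² < p` ⟹ a strong representative system of `AG(2,p)` with at least
`|X|·|K| - 2|K|` flags. [elementary] -/
theorem quadLift_box_srs (hd : ∀ n : ℤ, d ≠ n * n) (φ : ℤ√d →+* ZMod p) (m L : ℕ)
    (X K : Finset (ℤ√d))
    (hX : ∀ x ∈ X, 0 ≤ x.re ∧ x.re < m ∧ 0 ≤ x.im ∧ x.im < m)
    (hKbox : ∀ k ∈ K, 0 ≤ k.re ∧ k.re < L ∧ 0 ≤ k.im ∧ k.im < L)
    (hK : ∀ k ∈ K, ∀ k' ∈ K, ∀ z : ℤ√d, k - k' = z * z → z = 0)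
    (hB : ((1 + |d|) * (m : ℤ) ^ 2 + L) ^ 2 + |d| * (2 * (m : ℤ) ^ 2 + L) ^ 2 < p) :
    ∃ S : Finset ((Fin 2 → ZMod p) × (Fin 2 → ZMod p)), X.card * K.card ≤ S.card + 2 * K.card ∧
      ∀ f ∈ S, ∀ f' ∈ S, (dotProduct f.1 f'.2 = 1 ↔ f = f') := by
  refine quadLift_srs hd φ X K hK ?_
  intro x hx x' hx' k hk k' hk'
  refine lt_of_le_of_lt (abs_norm_sq_sub_le (x' - x) (k - k') m L (by positivity) ?_ ?_ ?_ ?_) hB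
  · rw [Zsqrtd.re_sub, abs_le]
    obtain ⟨h1, h2, -, -⟩ := hX x hx
    obtain ⟨h1', h2', -, -⟩ := hX x' hx'
    constructor <;> linarith
  · rw [Zsqrtd.im_sub, abs_le]
    obtain ⟨-, -, h1, h2⟩ := hX x hx
    obtain ⟨-, -, h1', h2'⟩ := hX x' hx'
    constructor <;> linarith
  · rw [Zsqrtd.re_sub, abs_le]
    obtain ⟨h1, h2, -, -⟩ := hKbox k hk
    obtain ⟨h1', h2', -, -⟩ := hKbox k' hk'
    constructor <;> linarith
  · rw [Zsqrtd.im_sub, abs_le]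
    obtain ⟨-, -, h1, h2⟩ := hKbox k hk
    obtain ⟨-, -, h1', h2'⟩ := hKbox k' hk'
    constructor <;> linarith

/-- The box `[0,m)²` of `ℤ√d` as a `Finset`, with `m²` elements. [elementary] -/
theorem exists_box (d : ℤ) (m : ℕ) : ∃ X : Finset (ℤ√d), X.card = m * m ∧
    ∀ x ∈ X, 0 ≤ x.re ∧ x.re < m ∧ 0 ≤ x.im ∧ x.im < m := by
  classical
  refine ⟨(range m ×ˢ range m).image fun ab => (⟨ab.1, ab.2⟩ : ℤ√d), ?_, ?_⟩
  · rw [card_image_of_injective, card_product, card_range]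
    rintro ⟨a, b⟩ ⟨a', b'⟩ h
    simp only [Zsqrtd.mk.injEq, Nat.cast_inj] at h
    rw [h.1, h.2]
  · intro x hx
    simp only [mem_image, mem_product, mem_range, Prod.exists] at hx
    obtain ⟨a, b, ⟨ha, hb⟩, rfl⟩ := hx
    exact ⟨by simp, by simpa using ha, by simp, by simpa using hb⟩

end Summit.MatrixMultiplication.MatrixMultiplication.Theorems.LevelOneGL2Designs.QuadraticLift
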